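import Summits.Ventures.PercRepro.C041PortProblemCaseIVB
import Summits.Ventures.PercRepro.C041PortProblemSwap

/-!
# The port problem of THEOREM R: THE LEMMA `0 ≤ Φ∨ P` and `0 ≤ Φ∧ P` (p6, gen 23)

Setting of `C041PortProblemDefs` (mine-3, C-041.md §3 / §6 (b)–(c)), singleton version.  For every port problem whose
ports are reachable from the root, the weight sums are nonnegative — by strong induction on the number of ports along
the gate case analysis: no port (`Φ = 0`); a non-switchable gate (case (iii), `C041PortProblemDefs`); a switchable gate
carrying both terminal edges (case (ii), `C041PortProblemCaseII`); two gates of pure types (case (iv),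
`C041PortProblemCaseIVA/B`); a unique switchable gate of pure type (case (v): `Φ (P.sub p) ≤ Φ P`,
`C041PortProblemCaseVSum` / `C041PortProblemSwap`, and the induction hypothesis on the sub-problem, which has one port
fewer and is connected from the gate, `sub_ports_reachable`).

* `phiOr_nonneg_of_M_empty`, `phiAnd_nonneg_of_M_empty` — no port;
* `phiOr_nonneg_of_card`, `phiAnd_nonneg_of_card` — the induction;
* **`phiOr_nonneg`**, **`phiAnd_nonneg`** — THE LEMMA: `0 ≤ Φ∨ P`, `0 ≤ Φ∧ P` whenever every port is reached from
  the root (in particular for every connected problem, `phiOr_nonneg_of_connected`).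

This is the combinatorial core of mine-3's THEOREM R (the per-colouring form of ROW C-041 `(G⅔)` on the sources with
internally red-connected attachments): the reduction from a skeleton to its port problem (C-041.md §6 (d)) is the
remaining step.  Own twin lean-drafts/p6/g23/twin/portprob.py: `Φ∨, Φ∧ ≥ 0` on 3,000 random connected instances.
-/

namespace PercRepro

namespace PortProblem

namespace Problem

open Finset

variable {V : Type*} [Fintype V] [DecidableEq V]

omit [Fintype V] [DecidableEq V] in
/-- Without ports there is no terminal edge. -/
theorem not_X₁_of_M_empty {P : Problem V} (hM : P.M = ∅) (x : P.Term → Bool) : ¬ P.X₁ x := by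
  rintro ⟨e, _, _⟩
  exact Finset.eq_empty_iff_forall_notMem.1 hM _ e.2.1

omit [Fintype V] [DecidableEq V] in
/-- Without ports there is no terminal edge. -/
theorem not_X₂_of_M_empty {P : Problem V} (hM : P.M = ∅) (x : P.Term → Bool) : ¬ P.X₂ x := by
  rintro ⟨e, _, _⟩
  exact Finset.eq_empty_iff_forall_notMem.1 hM _ e.2.1

open Classical in
/-- No port: `Φ∨ = 0`. -/
theorem phiOr_nonneg_of_M_empty {P : Problem V} (hM : P.M = ∅) : 0 ≤ P.phiOr := by
  unfold phiOr
  apply Finset.sum_nonneg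
  intro x _
  rw [if_neg (fun h => h.2.elim (not_X₁_of_M_empty hM x) (not_X₂_of_M_empty hM x))]

open Classical in
/-- No port: `Φ∧ = 0`. -/
theorem phiAnd_nonneg_of_M_empty {P : Problem V} (hM : P.M = ∅) : 0 ≤ P.phiAnd := by
  unfold phiAnd
  apply Finset.sum_nonneg
  intro x _
  rw [if_neg (fun h => not_X₁_of_M_empty hM x h.2.1)]

omit [Fintype V] [DecidableEq V] in
/-- A Boolean that is not `false` is `true`. -/
theorem Bool.eq_true_of_not_eq_false {b : Bool} (h : ¬ b = false) : b = true := by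
  cases b
  · exact absurd rfl h
  · rfl

omit [Fintype V] [DecidableEq V] in
/-- The sub-problem has one port fewer. -/
theorem card_sub_M [DecidableEq V] {P : Problem V} {p : V} (hp : p ∈ P.M) :
    (P.sub p).M.card = P.M.card - 1 :=
  Finset.card_erase_of_mem hp

/-- **THE LEMMA, `Φ∨`, by strong induction on the number of ports.** -/
theorem phiOr_nonneg_of_card : ∀ (n : ℕ) (P : Problem V), P.M.card = n →
    (∀ q ∈ P.M, Relation.ReflTransGen P.adj P.c q) → 0 ≤ P.phiOr := by
  intro n
  induction n using Nat.strong_induction_on with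
  | _ n ih =>
  intro P hn hconn
  by_cases hM : P.M = ∅
  · exact phiOr_nonneg_of_M_empty hM
  · obtain ⟨q, hq⟩ := Finset.nonempty_iff_ne_empty.2 hM
    obtain ⟨g, hg⟩ := exists_gate_of_reflTransGen hq (hconn q hq)
    by_cases hsw : P.sw g = false
    · exact phiOr_nonneg_of_forced_gate hg hsw
    have hsw' : P.sw g = true := Bool.eq_true_of_not_eq_false hsw
    -- the sub-problem is smaller and connected: the induction hypothesis for case (v)
    have hsub : ∀ (huniq : ∀ g', P.IsGate g' → g' = g), 0 ≤ (P.sub g).phiOr := by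
      intro huniq
      have hcard : (P.sub g).M.card < n := by
        rw [card_sub_M hg.mem, hn]
        have : 0 < n := by
          rw [← hn]
          exact Finset.card_pos.2 ⟨q, hq⟩
        omega
      exact ih _ hcard (P.sub g) rfl (sub_ports_reachable hg huniq hconn)
    cases h1 : P.k₁ g <;> cases h2 : P.k₂ g
    · -- no terminal edge: impossible
      exfalso
      rcases P.hk g hg.mem with h | h
      · rw [h1] at h
        exact Bool.noConfusion h
      · rw [h2] at h
        exact Bool.noConfusion h
    · -- type `{2}`
      by_cases huniq : ∀ g', P.IsGate g' → g' = g
      · exact le_trans (hsub huniq) (phiOr_sub_le' hg huniq h2 h1 hsw')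
      · obtain ⟨g', hg'⟩ := not_forall.1 huniq
        obtain ⟨hg', hne⟩ := Classical.not_imp.1 hg'
        by_cases hsw2 : P.sw g' = false
        · exact phiOr_nonneg_of_forced_gate hg' hsw2
        cases h1' : P.k₁ g' <;> cases h2' : P.k₂ g'
        · exfalso
          rcases P.hk g' hg'.mem with h | h
          · rw [h1'] at h
            exact Bool.noConfusion h
          · rw [h2'] at h
            exact Bool.noConfusion h
        · exact phiOr_nonneg_of_pure_gates_same₂ hg hg' (Ne.symm hne) h2 h2' h1 h1'
        · exact phiOr_nonneg_of_pure_gates_mixed hg' hg h1' h2' h2 h1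
        · exact phiOr_nonneg_of_twoType_gate hg' (Bool.eq_true_of_not_eq_false hsw2) h1' h2'
    · -- type `{1}`
      by_cases huniq : ∀ g', P.IsGate g' → g' = g
      · exact le_trans (hsub huniq) (phiOr_sub_le hg huniq h1 h2 hsw')
      · obtain ⟨g', hg'⟩ := not_forall.1 huniq
        obtain ⟨hg', hne⟩ := Classical.not_imp.1 hg'
        by_cases hsw2 : P.sw g' = false
        · exact phiOr_nonneg_of_forced_gate hg' hsw2
        cases h1' : P.k₁ g' <;> cases h2' : P.k₂ g'
        · exfalso
          rcases P.hk g' hg'.mem with h | h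
          · rw [h1'] at h
            exact Bool.noConfusion h
          · rw [h2'] at h
            exact Bool.noConfusion h
        · exact phiOr_nonneg_of_pure_gates_mixed hg hg' h1 h2 h2' h1'
        · exact phiOr_nonneg_of_pure_gates_same₁ hg hg' (Ne.symm hne) h1 h1' h2 h2'
        · exact phiOr_nonneg_of_twoType_gate hg' (Bool.eq_true_of_not_eq_false hsw2) h1' h2'
    · -- type `{1, 2}`
      exact phiOr_nonneg_of_twoType_gate hg hsw' h1 h2

/-- **THE LEMMA, `Φ∧`, by strong induction on the number of ports.** -/
theorem phiAnd_nonneg_of_card : ∀ (n : ℕ) (P : Problem V), P.M.card = n →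
    (∀ q ∈ P.M, Relation.ReflTransGen P.adj P.c q) → 0 ≤ P.phiAnd := by
  intro n
  induction n using Nat.strong_induction_on with
  | _ n ih =>
  intro P hn hconn
  by_cases hM : P.M = ∅
  · exact phiAnd_nonneg_of_M_empty hM
  · obtain ⟨q, hq⟩ := Finset.nonempty_iff_ne_empty.2 hM
    obtain ⟨g, hg⟩ := exists_gate_of_reflTransGen hq (hconn q hq)
    by_cases hsw : P.sw g = false
    · exact phiAnd_nonneg_of_forced_gate hg hsw
    have hsw' : P.sw g = true := Bool.eq_true_of_not_eq_false hsw
    have hsub : ∀ (huniq : ∀ g', P.IsGate g' → g' = g), 0 ≤ (P.sub g).phiAnd := by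
      intro huniq
      have hcard : (P.sub g).M.card < n := by
        rw [card_sub_M hg.mem, hn]
        have : 0 < n := by
          rw [← hn]
          exact Finset.card_pos.2 ⟨q, hq⟩
        omega
      exact ih _ hcard (P.sub g) rfl (sub_ports_reachable hg huniq hconn)
    cases h1 : P.k₁ g <;> cases h2 : P.k₂ g
    · exfalso
      rcases P.hk g hg.mem with h | h
      · rw [h1] at h
        exact Bool.noConfusion h
      · rw [h2] at h
        exact Bool.noConfusion h
    · by_cases huniq : ∀ g', P.IsGate g' → g' = g
      · exact le_trans (hsub huniq) (phiAnd_sub_le' hg huniq h2 h1 hsw')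
      · obtain ⟨g', hg'⟩ := not_forall.1 huniq
        obtain ⟨hg', hne⟩ := Classical.not_imp.1 hg'
        by_cases hsw2 : P.sw g' = false
        · exact phiAnd_nonneg_of_forced_gate hg' hsw2
        cases h1' : P.k₁ g' <;> cases h2' : P.k₂ g'
        · exfalso
          rcases P.hk g' hg'.mem with h | h
          · rw [h1'] at h
            exact Bool.noConfusion h
          · rw [h2'] at h
            exact Bool.noConfusion h
        · exact phiAnd_nonneg_of_pure_gates_same₂ hg hg' (Ne.symm hne) h2 h2' h1 h1'
        · exact phiAnd_nonneg_of_pure_gates_mixed hg' hg h1' h2' h2 h1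
        · exact phiAnd_nonneg_of_twoType_gate hg' (Bool.eq_true_of_not_eq_false hsw2) h1' h2'
    · by_cases huniq : ∀ g', P.IsGate g' → g' = g
      · exact le_trans (hsub huniq) (phiAnd_sub_le hg huniq h1 h2 hsw')
      · obtain ⟨g', hg'⟩ := not_forall.1 huniq
        obtain ⟨hg', hne⟩ := Classical.not_imp.1 hg'
        by_cases hsw2 : P.sw g' = false
        · exact phiAnd_nonneg_of_forced_gate hg' hsw2
        cases h1' : P.k₁ g' <;> cases h2' : P.k₂ g'
        · exfalso
          rcases P.hk g' hg'.mem with h | h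
          · rw [h1'] at h
            exact Bool.noConfusion h
          · rw [h2'] at h
            exact Bool.noConfusion h
        · exact phiAnd_nonneg_of_pure_gates_mixed hg hg' h1 h2 h2' h1'
        · exact phiAnd_nonneg_of_pure_gates_same₁ hg hg' (Ne.symm hne) h1 h1' h2 h2'
        · exact phiAnd_nonneg_of_twoType_gate hg' (Bool.eq_true_of_not_eq_false hsw2) h1' h2'
    · exact phiAnd_nonneg_of_twoType_gate hg hsw' h1 h2

/-- **THE LEMMA (mine-3, C-041.md §3 / §6 (b)), `Φ∨`**: on every port problem whose ports are reached from the
root, `0 ≤ Φ∨ P`. -/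
theorem phiOr_nonneg (P : Problem V) (hconn : ∀ q ∈ P.M, Relation.ReflTransGen P.adj P.c q) :
    0 ≤ P.phiOr :=
  phiOr_nonneg_of_card _ P rfl hconn

/-- **THE LEMMA, `Φ∧`**: on every port problem whose ports are reached from the root, `0 ≤ Φ∧ P`. -/
theorem phiAnd_nonneg (P : Problem V) (hconn : ∀ q ∈ P.M, Relation.ReflTransGen P.adj P.c q) :
    0 ≤ P.phiAnd :=
  phiAnd_nonneg_of_card _ P rfl hconn

/-- THE LEMMA on a connected problem. -/
theorem phiOr_nonneg_of_connected (P : Problem V) (hconn : P.Connected) : 0 ≤ P.phiOr :=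
  phiOr_nonneg P fun q _ => hconn q

/-- THE LEMMA on a connected problem. -/
theorem phiAnd_nonneg_of_connected (P : Problem V) (hconn : P.Connected) : 0 ≤ P.phiAnd :=
  phiAnd_nonneg P fun q _ => hconn q

end Problem

end PortProblem

end PercRepro
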